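import Mathlib

/-!
# SoloBlindSimilarityAllOrNothing — two similarities out of one quadratic space whose multipliers have square ratio differ by an isometry

solo-HodgeConjecture-blind, session s22 (`paper/k3-weil-faces.md` §3.3, the all-or-nothing lemma for Hodge
similarities of K3 surfaces).

Setting of the application: `V = T(S)_ℚ`, `W = T(S′)_ℚ`, `U = T(S″)_ℚ` are rational transcendental lattices of
complex projective K3 surfaces with their intersection forms `BV, BW, BU`; `ψ : V ≃ W` and `χ : V ≃ U` are Hodge
similarities with multipliers `dψ, dχ` (`BW (ψ x) (ψ y) = dψ · BV x y`), and `dψ = c² · dχ`.  "Algebraic" (induced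
by an algebraic cycle on the product surface) is an abstract predicate on linear maps between each pair of spaces,
closed under composition and under rational scalars; Buskin's theorem (every rational Hodge isometry between K3
surfaces is algebraic, Crelle 755 (2019); Huybrechts arXiv:1705.04063 Thm 2) is the hypothesis `buskin`.
Conclusion: if `χ` is algebraic then so is `ψ` — because `ψ = (ψ ∘ χ⁻¹) ∘ χ` and `c⁻¹ · ψ ∘ χ⁻¹` is an isometry.
Hence, for a fixed K3 surface `S` and a fixed square class `d`, algebraicity of multiplier-`d` Hodge similarities
out of `T(S)_ℚ` is all-or-nothing (Varesco's mechanism, arXiv:2304.02519 §2), and one algebraic partner — e.g. the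
isogeny correspondence of a degree-`d` isogeny of abelian surfaces, for Kummer surfaces — decides them all.

Only the linear algebra is formalised; Hodge structures enter through the abstract predicates.
-/

namespace Summit.HodgeConjecture.HodgeConjecture.Theorems

open LinearMap

variable {V W U : Type*} [AddCommGroup V] [Module ℚ V] [AddCommGroup W] [Module ℚ W]
  [AddCommGroup U] [Module ℚ U]

/-- The all-or-nothing lemma for similarities.  `AlgVW, AlgVU, AlgUW` are abstract "algebraicity" predicates on
linear maps, closed under composition (`comp_closed`) and rational scalars (`smul_closed`), and containing every
bijective isometry `U → W` (`buskin`).  If `ψ : V ≃ W` and `χ : V ≃ U` are similarities for the bilinear forms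
`BV, BW, BU` with multipliers `dψ = c ^ 2 * dχ`, `c ≠ 0`, `dχ ≠ 0`, and `χ` is algebraic, then `ψ` is algebraic. -/
theorem alg_of_similarity_of_sq_ratio
    (BV : LinearMap.BilinForm ℚ V) (BW : LinearMap.BilinForm ℚ W) (BU : LinearMap.BilinForm ℚ U)
    (AlgVW : (V →ₗ[ℚ] W) → Prop) (AlgVU : (V →ₗ[ℚ] U) → Prop) (AlgUW : (U →ₗ[ℚ] W) → Prop)
    (comp_closed : ∀ (f : U →ₗ[ℚ] W) (g : V →ₗ[ℚ] U), AlgUW f → AlgVU g → AlgVW (f ∘ₗ g))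
    (smul_closed : ∀ (a : ℚ) (f : U →ₗ[ℚ] W), AlgUW f → AlgUW (a • f))
    (buskin : ∀ f : U →ₗ[ℚ] W, Function.Bijective f →
      (∀ x y, BW (f x) (f y) = BU x y) → AlgUW f)
    (ψ : V ≃ₗ[ℚ] W) (χ : V ≃ₗ[ℚ] U) (dψ dχ c : ℚ) (hc : c ≠ 0) (hdχ : dχ ≠ 0)
    (hratio : dψ = c ^ 2 * dχ)
    (hψ : ∀ x y, BW (ψ x) (ψ y) = dψ * BV x y) (hχ : ∀ x y, BU (χ x) (χ y) = dχ * BV x y)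
    (hAlgχ : AlgVU χ.toLinearMap) :
    AlgVW ψ.toLinearMap := by
  -- the candidate isometry `f = c⁻¹ • ψ ∘ χ⁻¹ : U → W`
  set f : U →ₗ[ℚ] W := c⁻¹ • (ψ.toLinearMap ∘ₗ χ.symm.toLinearMap) with hf
  have hf_apply : ∀ u, f u = c⁻¹ • ψ (χ.symm u) := by
    intro u; simp [hf]
  -- `f` is bijective: explicit two-sided inverse `u ↦ χ (ψ⁻¹ (c • w))`
  have hbij : Function.Bijective f := by
    refine Function.bijective_iff_has_inverse.mpr ⟨fun w => χ (ψ.symm (c • w)), ?_, ?_⟩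
    · intro u
      simp [hf_apply, smul_smul, mul_inv_cancel₀ hc]
    · intro w
      simp [hf_apply, smul_smul, inv_mul_cancel₀ hc]
  -- `f` is an isometry
  have hiso : ∀ x y, BW (f x) (f y) = BU x y := by
    intro x y
    have h1 : BU x y = dχ * BV (χ.symm x) (χ.symm y) := by
      simpa using hχ (χ.symm x) (χ.symm y)
    rw [hf_apply, hf_apply, LinearMap.BilinForm.smul_left, LinearMap.BilinForm.smul_right, hψ, h1, hratio]
    field_simp
  have hAlgf : AlgUW f := buskin f hbij hiso
  -- `ψ = (c • f) ∘ χ`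
  have hdecomp : (c • f) ∘ₗ χ.toLinearMap = ψ.toLinearMap := by
    ext v
    simp [hf_apply, smul_smul, mul_inv_cancel₀ hc]
  rw [← hdecomp]
  exact comp_closed _ _ (smul_closed c f hAlgf) hAlgχ

/-- Symmetric packaging ("all-or-nothing"): under the same closure hypotheses in both directions, `ψ` is algebraic
iff `χ` is, whenever the two multipliers have square ratio. -/
theorem alg_iff_alg_of_sq_ratio
    (BV : LinearMap.BilinForm ℚ V) (BW : LinearMap.BilinForm ℚ W) (BU : LinearMap.BilinForm ℚ U)
    (AlgVW : (V →ₗ[ℚ] W) → Prop) (AlgVU : (V →ₗ[ℚ] U) → Prop)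
    (AlgUW : (U →ₗ[ℚ] W) → Prop) (AlgWU : (W →ₗ[ℚ] U) → Prop)
    (comp_closed₁ : ∀ (f : U →ₗ[ℚ] W) (g : V →ₗ[ℚ] U), AlgUW f → AlgVU g → AlgVW (f ∘ₗ g))
    (comp_closed₂ : ∀ (f : W →ₗ[ℚ] U) (g : V →ₗ[ℚ] W), AlgWU f → AlgVW g → AlgVU (f ∘ₗ g))
    (smul_closed₁ : ∀ (a : ℚ) (f : U →ₗ[ℚ] W), AlgUW f → AlgUW (a • f))
    (smul_closed₂ : ∀ (a : ℚ) (f : W →ₗ[ℚ] U), AlgWU f → AlgWU (a • f))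
    (buskin₁ : ∀ f : U →ₗ[ℚ] W, Function.Bijective f →
      (∀ x y, BW (f x) (f y) = BU x y) → AlgUW f)
    (buskin₂ : ∀ f : W →ₗ[ℚ] U, Function.Bijective f →
      (∀ x y, BU (f x) (f y) = BW x y) → AlgWU f)
    (ψ : V ≃ₗ[ℚ] W) (χ : V ≃ₗ[ℚ] U) (dψ dχ c : ℚ) (hc : c ≠ 0) (hdψ : dψ ≠ 0) (hdχ : dχ ≠ 0)
    (hratio : dψ = c ^ 2 * dχ)
    (hψ : ∀ x y, BW (ψ x) (ψ y) = dψ * BV x y) (hχ : ∀ x y, BU (χ x) (χ y) = dχ * BV x y) :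
    AlgVW ψ.toLinearMap ↔ AlgVU χ.toLinearMap := by
  constructor
  · intro hAlgψ
    have hratio' : dχ = c⁻¹ ^ 2 * dψ := by
      rw [hratio]; field_simp
    exact alg_of_similarity_of_sq_ratio BV BU BW AlgVU AlgVW AlgWU comp_closed₂ smul_closed₂ buskin₂
      χ ψ dχ dψ c⁻¹ (inv_ne_zero hc) hdψ hratio' hχ hψ hAlgψ
  · intro hAlgχ
    exact alg_of_similarity_of_sq_ratio BV BW BU AlgVW AlgVU AlgUW comp_closed₁ smul_closed₁ buskin₁
      ψ χ dψ dχ c hc hdχ hratio hψ hχ hAlgχ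

end Summit.HodgeConjecture.HodgeConjecture.Theorems
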